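/-
Copyright (c) 2026 the pub-hodgecm-mathlib formalisation cell (harness21).  Prover seat hodgecm-mathlib-K2E1-p10 (g0), Track B ∕ K2-LIT, h413 = `stmt-HodgeConjecture-24833`,
line `K2_E1_TraceFormulaBeta`, campaign «EIS-WHITTAKER-3», DEAL D-W4 «W2₃-fin-split» of the dealer K2E1-plan (g5) 2026-09-04T08:09:42Z (DEALS MEMO fe56b7cd5d935977),
FILE B of three: the inner `y`-integral and THE FIBRE OVER `x` of the ψ-TWISTED big-cell integral of `GL₃(F)` — values on `𝒪` and on the sphere `‖x‖ = q`, radiality, integrability.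
-/
import Summits.HodgeConjecture.HodgeConjecture.Theorems.K2E1FiniteWhittakerSplitU3Inner   -- ★ FILE A (this seat): the shell formula, floor integrals of level 0∕1, the inner `y`-integral
import HarnessLib

/-!
# K2·E1 — `K2E1FiniteWhittakerSplitU3Fibre` (D-W4 FILE B): `I(x,z) = ∫_y max(1,‖y‖,‖z−xy‖)^{−s}ψ(yξ) dμ` and the `x`-fibre `Fib(x) = ∫_z max(1,‖x‖,‖z‖)^{−s}·I(x,z) dμ(z)`

Track B ∕ K2-LIT, crux h413 = `stmt-HodgeConjecture-24833`, route of record `HCCMUnconditional`; cell `hodgecm-mathlib`, squad K2, ENGINE E1, campaign «EIS-WHITTAKER-3», D-W4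
(CONVENTIONS W0₃ 2fdd2f7063acaab9 §3∕§4 (ii′)).  THEOREMS ONLY (no `def`, no `instance`, no notation, no named-fact hypothesis, no `sorry`).  Notation and currency as in FILE A
(`G_η(w) = ∫_u max(1,‖w‖,‖u‖)^{−s} ψ(uη) dμ`, `c := q^{−s}`).
* §4 THE INNER INTEGRAL: `‖x‖ ≤ 1 ⟹ I(x,z) = 𝟙_𝒪(z)·μ(𝒪)(1 − c)` at a frequency of level zero (★ §1 `max(‖y‖,‖z−xy‖) = max(‖y‖,‖z‖)`, FILE A §3); `‖x‖ ≥ 1 ⟹ I(x,z) =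
  ψ(x⁻¹zξ)·‖x‖⁻¹·G_{x⁻¹ξ}(x⁻¹z)` for EVERY `ψ, ξ, s` (translation `y ↦ x⁻¹z + y`, ★ §1 `max(‖x⁻¹z + y‖, ‖x‖‖y‖) = max(‖x⁻¹z‖, ‖x‖‖y‖)`, dilation `y ↦ x⁻¹u`, ★ `integral_comp_mul_left`);
* §5 `Fib(x) = μ(𝒪)²(1 − c)` for `‖x‖ ≤ 1` at a frequency of level zero (`ξ ∈ 𝔭^m ∖ 𝔭^{m+1}`, `Re s > 1`: FILE A §4 + the indicator integral); for `‖x‖ ≥ 1` and EVERY `ψ, ξ, s` the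
  substitution `z = xz'` gives `Fib(x) = ‖x‖^{−s}·∫_{z'} (max(1,‖z'‖)^{−s}·G_{x⁻¹ξ}(z')) ψ(z'ξ) dμ` — a radial weight against the character again — whence, by FILE A §1 (level zero in
  `z'`) and §3 (level one for `G_{x⁻¹ξ}`), ON THE SPHERE `‖x‖ = q`: **`Fib(x) = μ(𝒪)²·c·(1 + (q−1)c − 2qc² + qc³)`**;
* §6 `Fib` is RADIAL (`z ↦ vz`, `v = x'x⁻¹` a unit) and INTEGRABLE for `Re s > 1` (its modulus is dominated by the `x`-marginal of the ★ Haar-form Gindikin–Karpelevich integrand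
  `max(1,‖x‖,‖z‖)^{−σ}max(1,‖y‖,‖z−xy‖)^{−σ}`, `σ = Re s`, ★ `integrable_bigCellIntegrand`; measurability via `AEStronglyMeasurable.integral_prod_right'`), for EVERY `ψ, ξ`.
FILE C `K2E1FiniteWhittakerSplitU3` applies FILE A §1 a last time, in `x`, to get the unit value `μ(𝒪)³(1 − c)²(1 − qc²)`.
SAT-WITNESS: nothing is quantified over a structure (`F` any non-archimedean local field, `μ` any additive Haar measure, `ψ` any continuous additive character).
HONEST LABEL: HC_CM is proved only modulo the 7 printed citations (2 remaining named inputs: hLiu418 = `stmt-HodgeConjecture-24832`, h413 = `stmt-HodgeConjecture-24833`)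
until rung 0 closes; this file asserts no named fact and closes no socket (lane `--supports stmt-HodgeConjecture-24833`, count-neutral).
References: [Casselman1980] §3, Thm. 3.1 · [CasselmanShalika1980] Thm. 5.4 · [Tate1950] §2.2 Lemma 2.2.5 · [Langlands1971] §3.
-/

set_option autoImplicit false
-- the mandated namespace repeats the single-problem summit's segment (`HodgeConjecture.HodgeConjecture`)
set_option linter.dupNamespace false

noncomputable section

open MeasureTheory Filter Topology Set TopologicalSpace
open scoped NNReal ENNReal
open Literature.NumberTheory.GaloisRepresentations Literature.NumberTheory.GaloisRepresentations.IsNonarchimedeanLocalField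
open Literature.NumberTheory.Automorphic Literature.NumberTheory.Automorphic.LocalFieldHaar
open Summit.HodgeConjecture.HodgeConjecture.Cruxes.HLiu418.K2LiuGKRankOneIntegral
open Summit.HodgeConjecture.HodgeConjecture.Cruxes.H413.K2E1IntertwiningLocalFactorU2 (integrable_max_one_normAbs_rpow_neg integral_max_one_normAbs_rpow_neg)
open Summit.HodgeConjecture.HodgeConjecture.Cruxes.H413.K2E1GindikinKarpelevichSplitGL3
open Summit.HodgeConjecture.HodgeConjecture.Cruxes.H413.K2E1GindikinKarpelevichSplitGL3Haar
open Summit.HodgeConjecture.HodgeConjecture.Cruxes.H413.K2E1FiniteWhittakerSplitU3Inner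

namespace Summit.HodgeConjecture.HodgeConjecture.Cruxes.H413.K2E1FiniteWhittakerSplitU3Fibre

variable {F : Type*} [Field F] [ValuativeRel F] [TopologicalSpace F] [IsNonarchimedeanLocalField F]
variable [MeasurableSpace F] [BorelSpace F] (μ : Measure F) [μ.IsAddHaarMeasure]

/-! ## §4  The inner `y`-integral `I(x,z) = ∫_y max(1,‖y‖,‖z−xy‖)^{−s} ψ₂(yξ₂) dμ(y)` -/

omit [BorelSpace F] [μ.IsAddHaarMeasure] in
/-- For `‖x‖ ≤ 1` the twist by `x` is invisible: `I(x,z) = ∫_u max(1,‖z‖,‖u‖)^{−s} ψ₂(uξ₂) dμ` (★ §1 `max(‖y‖,‖z−xy‖) = max(‖y‖,‖z‖)`). [cite: Casselman1980, Thm. 3.1] -/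
theorem integral_inner_twisted_eq_floor_of_le_one {x : F} (hx : normAbs F x ≤ 1) (ψ : AddChar F Circle) (ξ : F) (s : ℂ) (z : F) :
    ∫ y, ((max 1 (max ((normAbs F y : ℝ≥0) : ℝ) ((normAbs F (z - x * y) : ℝ≥0) : ℝ)) : ℝ) : ℂ) ^ (-s) * ((ψ (y * ξ) : Circle) : ℂ) ∂μ =
      ∫ u, ((max 1 (max ((normAbs F z : ℝ≥0) : ℝ) ((normAbs F u : ℝ≥0) : ℝ)) : ℝ) : ℂ) ^ (-s) * ((ψ (u * ξ) : Circle) : ℂ) ∂μ := by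
  refine integral_congr_ae (Eventually.of_forall fun y => ?_)
  simp only
  rw [← NNReal.coe_max, max_normAbs_sub_mul_of_le_one hx, NNReal.coe_max, max_comm ((normAbs F y : ℝ≥0) : ℝ)]

/-- **`I(x,z)` FOR `‖x‖ ≤ 1`, UNIT FREQUENCY** (`ψ₂` of conductor exponent `m`, `ξ₂ ∈ 𝔭^m ∖ 𝔭^{m+1}`, `Re s > 1`): `I(x,z) = 𝟙_𝒪(z)·μ(𝒪)(1 − q^{−s})`.
[cite: Casselman1980, Thm. 3.1] [cite: Tate1950, §2.5] -/
theorem integral_inner_twisted_of_le_one {x : F} (hx : normAbs F x ≤ 1) {ψ : AddChar F Circle} (hψ : Continuous ψ) {m : ℤ} (hm : ψ.HasConductorExp m)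
    {ξ : F} (hξ : ξ ∈ primePowBall F m) (hξ' : ξ ∉ primePowBall F (m + 1)) {s : ℂ} (hs : 1 < s.re) (z : F) :
    ∫ y, ((max 1 (max ((normAbs F y : ℝ≥0) : ℝ) ((normAbs F (z - x * y) : ℝ≥0) : ℝ)) : ℝ) : ℂ) ^ (-s) * ((ψ (y * ξ) : Circle) : ℂ) ∂μ =
      Set.indicator (primePowBall F 0) (fun _ => (μ.real (primePowBall F 0) : ℂ) * (1 - (residueFieldCard F : ℂ) ^ (-s))) z := by
  rw [integral_inner_twisted_eq_floor_of_le_one μ hx ψ ξ s z]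
  by_cases hz : z ∈ primePowBall F 0
  · rw [Set.indicator_of_mem hz, integral_floorWeight_mul_addChar_of_level_zero_of_mem μ hψ hm hξ hξ' hs hz]
  · rw [Set.indicator_of_notMem hz, integral_floorWeight_mul_addChar_of_level_zero_of_not_mem μ hψ hm hξ hξ' hs hz]

/-- **`I(x,z)` FOR `‖x‖ ≥ 1`, ANY FREQUENCY** (pure Haar calculus, every `ψ`, `ξ`, `s`): writing `z − xy = x(x⁻¹z − y)`, translating `y ↦ x⁻¹z + y` (★ §1
`max(‖x⁻¹z + y‖, ‖x‖‖y‖) = max(‖x⁻¹z‖, ‖x‖‖y‖)`, and `ψ((x⁻¹z + y)ξ) = ψ(x⁻¹zξ)ψ(yξ)`) and rescaling `y ↦ x⁻¹u` (Jacobian `‖x‖⁻¹`, `ψ(yξ) = ψ(u·x⁻¹ξ)`):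
`I(x,z) = ψ(x⁻¹zξ) · ‖x‖⁻¹ · ∫_u max(1,‖x⁻¹z‖,‖u‖)^{−s} ψ(u·x⁻¹ξ) dμ(u)` — a floor integral at the DILATED frequency `x⁻¹ξ`.
[cite: Casselman1980, Thm. 3.1] [cite: Tate1950, §2.2 Lemma 2.2.5] -/
theorem integral_inner_twisted_of_one_le {x : F} (hx : 1 ≤ normAbs F x) (ψ : AddChar F Circle) (ξ : F) (s : ℂ) (z : F) :
    ∫ y, ((max 1 (max ((normAbs F y : ℝ≥0) : ℝ) ((normAbs F (z - x * y) : ℝ≥0) : ℝ)) : ℝ) : ℂ) ^ (-s) * ((ψ (y * ξ) : Circle) : ℂ) ∂μ =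
      ((ψ (x⁻¹ * z * ξ) : Circle) : ℂ) * (((normAbs F x : ℝ≥0) : ℝ)⁻¹ *
        ∫ u, ((max 1 (max ((normAbs F (x⁻¹ * z) : ℝ≥0) : ℝ) ((normAbs F u : ℝ≥0) : ℝ)) : ℝ) : ℂ) ^ (-s) * ((ψ (u * (x⁻¹ * ξ)) : Circle) : ℂ) ∂μ) := by
  have hx0 : x ≠ 0 := by
    rintro rfl
    rw [map_zero] at hx
    exact not_lt.2 hx zero_lt_one
  have hmul : ∀ y : F, x * y * (x⁻¹ * ξ) = y * ξ := fun y => by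
    rw [mul_assoc, mul_left_comm y, ← mul_assoc, mul_inv_cancel₀ hx0, one_mul]
  -- (i) `z − x y = x (x⁻¹ z − y)` and translation `y ↦ x⁻¹ z + y`
  have hpt : ∀ y : F, max ((normAbs F y : ℝ≥0) : ℝ) ((normAbs F (z - x * y) : ℝ≥0) : ℝ) =
      max ((normAbs F y : ℝ≥0) : ℝ) (((normAbs F x : ℝ≥0) : ℝ) * ((normAbs F (x⁻¹ * z - y) : ℝ≥0) : ℝ)) := by
    intro y
    rw [show z - x * y = x * (x⁻¹ * z - y) by rw [mul_sub, mul_inv_cancel_left₀ hx0], map_mul, NNReal.coe_mul]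
  simp_rw [hpt]
  rw [← integral_add_left_eq_self _ (x⁻¹ * z)]
  have hpt2 : ∀ y : F, max ((normAbs F (x⁻¹ * z + y) : ℝ≥0) : ℝ) (((normAbs F x : ℝ≥0) : ℝ) * ((normAbs F (x⁻¹ * z - (x⁻¹ * z + y)) : ℝ≥0) : ℝ)) =
      max ((normAbs F (x⁻¹ * z) : ℝ≥0) : ℝ) ((normAbs F (x * y) : ℝ≥0) : ℝ) := by
    intro y
    rw [show x⁻¹ * z - (x⁻¹ * z + y) = -y by abel, normAbs_neg, ← NNReal.coe_mul, ← NNReal.coe_max,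
      max_normAbs_add_mul_of_one_le hx, ← map_mul, NNReal.coe_max]
  have hchar : ∀ y : F, ((ψ ((x⁻¹ * z + y) * ξ) : Circle) : ℂ) = ((ψ (x⁻¹ * z * ξ) : Circle) : ℂ) * ((ψ (x * y * (x⁻¹ * ξ)) : Circle) : ℂ) := by
    intro y
    rw [add_mul, AddChar.map_add_eq_mul, Circle.coe_mul, hmul y]
  simp_rw [hpt2, hchar]
  have hre : ∀ y : F, ((max 1 (max ((normAbs F (x⁻¹ * z) : ℝ≥0) : ℝ) ((normAbs F (x * y) : ℝ≥0) : ℝ)) : ℝ) : ℂ) ^ (-s) *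
      (((ψ (x⁻¹ * z * ξ) : Circle) : ℂ) * ((ψ (x * y * (x⁻¹ * ξ)) : Circle) : ℂ)) =
      ((ψ (x⁻¹ * z * ξ) : Circle) : ℂ) * (((max 1 (max ((normAbs F (x⁻¹ * z) : ℝ≥0) : ℝ) ((normAbs F (x * y) : ℝ≥0) : ℝ)) : ℝ) : ℂ) ^ (-s) *
        ((ψ (x * y * (x⁻¹ * ξ)) : Circle) : ℂ)) := fun y => by ring
  simp_rw [hre]
  rw [integral_const_mul]
  congr 1
  -- (ii) rescale `y ↦ x⁻¹ u`: `∫ H(x y) dμ(y) = ‖x‖⁻¹ ∫ H dμ`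
  have hsub := integral_comp_mul_left μ hx0 (fun u : F => ((max 1 (max ((normAbs F (x⁻¹ * z) : ℝ≥0) : ℝ) ((normAbs F u : ℝ≥0) : ℝ)) : ℝ) : ℂ) ^ (-s) *
        ((ψ (u * (x⁻¹ * ξ)) : Circle) : ℂ))
  simp only [map_inv₀, NNReal.coe_inv] at hsub
  rw [hsub, Complex.real_smul]



/-! ## §5  The fibre over `x`: `Fib(x) = ∫_z max(1,‖x‖,‖z‖)^{−s} · I(x,z) dμ(z)` -/

/-- **THE FIBRE FOR `‖x‖ ≤ 1`** (`ψ` of conductor exponent `m`, `ξ ∈ 𝔭^m ∖ 𝔭^{m+1}`, `Re s > 1`): `Fib(x) = μ(𝒪)²·(1 − q^{−s})` — by §4 the inner integral is `𝟙_𝒪(z)μ(𝒪)(1 − q^{−s})` and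
on `𝒪` the first height factor is `1`. [cite: Casselman1980, Thm. 3.1] [cite: CasselmanShalika1980, Thm. 5.4] -/
theorem integral_fibre_twisted_of_le_one {x : F} (hx : normAbs F x ≤ 1) {ψ : AddChar F Circle} (hψ : Continuous ψ) {m : ℤ} (hm : ψ.HasConductorExp m)
    {ξ : F} (hξ : ξ ∈ primePowBall F m) (hξ' : ξ ∉ primePowBall F (m + 1)) {s : ℂ} (hs : 1 < s.re) :
    ∫ z, ((max 1 (max ((normAbs F x : ℝ≥0) : ℝ) ((normAbs F z : ℝ≥0) : ℝ)) : ℝ) : ℂ) ^ (-s) *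
        (∫ y, ((max 1 (max ((normAbs F y : ℝ≥0) : ℝ) ((normAbs F (z - x * y) : ℝ≥0) : ℝ)) : ℝ) : ℂ) ^ (-s) * ((ψ (y * ξ) : Circle) : ℂ) ∂μ) ∂μ =
      (μ.real (primePowBall F 0) : ℂ) ^ 2 * (1 - (residueFieldCard F : ℂ) ^ (-s)) := by
  simp_rw [integral_inner_twisted_of_le_one μ hx hψ hm hξ hξ' hs]
  have hx' : ((normAbs F x : ℝ≥0) : ℝ) ≤ 1 := by exact_mod_cast hx
  have hpt : ∀ z : F, ((max 1 (max ((normAbs F x : ℝ≥0) : ℝ) ((normAbs F z : ℝ≥0) : ℝ)) : ℝ) : ℂ) ^ (-s) *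
      Set.indicator (primePowBall F 0) (fun _ => (μ.real (primePowBall F 0) : ℂ) * (1 - (residueFieldCard F : ℂ) ^ (-s))) z =
      Set.indicator (primePowBall F 0) (fun _ => (μ.real (primePowBall F 0) : ℂ) * (1 - (residueFieldCard F : ℂ) ^ (-s))) z := by
    intro z
    by_cases hz : z ∈ primePowBall F 0
    · rw [Set.indicator_of_mem hz, max_eq_left (max_le hx' (coe_normAbs_le_one_of_mem hz)), Complex.ofReal_one, Complex.one_cpow, one_mul]
    · rw [Set.indicator_of_notMem hz, mul_zero]
  simp_rw [hpt]
  rw [integral_indicator_const _ (measurableSet_primePowBall 0), Complex.real_smul]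
  ring

/-- **THE FIBRE FOR `‖x‖ ≥ 1`, ANY FREQUENCY** (every `ψ`, `ξ`, `s`): substituting `z = x z'` (Jacobian `‖x‖`; `x⁻¹z = z'`, `max(1,‖x‖,‖x‖‖z'‖) = ‖x‖·max(1,‖z'‖)`) in §4's formula,
`Fib(x) = ‖x‖^{−s} · ∫_{z'} ( max(1,‖z'‖)^{−s} · G_{x⁻¹ξ}(z') ) ψ(z'ξ) dμ(z')`, `G_η(w) = ∫_u max(1,‖w‖,‖u‖)^{−s} ψ(uη) dμ` — again a RADIAL function against the character.
[cite: Casselman1980, Thm. 3.1] [cite: Tate1950, §2.2 Lemma 2.2.5] -/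
theorem integral_fibre_twisted_of_one_le {x : F} (hx : 1 ≤ normAbs F x) (ψ : AddChar F Circle) (ξ : F) (s : ℂ) :
    ∫ z, ((max 1 (max ((normAbs F x : ℝ≥0) : ℝ) ((normAbs F z : ℝ≥0) : ℝ)) : ℝ) : ℂ) ^ (-s) *
        (∫ y, ((max 1 (max ((normAbs F y : ℝ≥0) : ℝ) ((normAbs F (z - x * y) : ℝ≥0) : ℝ)) : ℝ) : ℂ) ^ (-s) * ((ψ (y * ξ) : Circle) : ℂ) ∂μ) ∂μ =
      (((normAbs F x : ℝ≥0) : ℝ) : ℂ) ^ (-s) *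
        ∫ z, (((max 1 ((normAbs F z : ℝ≥0) : ℝ) : ℝ) : ℂ) ^ (-s) *
            ∫ u, ((max 1 (max ((normAbs F z : ℝ≥0) : ℝ) ((normAbs F u : ℝ≥0) : ℝ)) : ℝ) : ℂ) ^ (-s) * ((ψ (u * (x⁻¹ * ξ)) : Circle) : ℂ) ∂μ) *
          ((ψ (z * ξ) : Circle) : ℂ) ∂μ := by
  have hx0 : x ≠ 0 := by
    rintro rfl
    rw [map_zero] at hx
    exact not_lt.2 hx zero_lt_one
  have hxR : (1 : ℝ) ≤ ((normAbs F x : ℝ≥0) : ℝ) := by exact_mod_cast hx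
  have hxpos : (0 : ℝ) < ((normAbs F x : ℝ≥0) : ℝ) := one_pos.trans_le hxR
  simp_rw [integral_inner_twisted_of_one_le μ hx ψ ξ s]
  -- substitute `z = x z'`
  have hsub := integral_comp_mul_left μ hx0 (fun z : F => ((max 1 (max ((normAbs F x : ℝ≥0) : ℝ) ((normAbs F z : ℝ≥0) : ℝ)) : ℝ) : ℂ) ^ (-s) *
      (((ψ (x⁻¹ * z * ξ) : Circle) : ℂ) * ((((normAbs F x : ℝ≥0) : ℝ)⁻¹ : ℝ) *
        ∫ u, ((max 1 (max ((normAbs F (x⁻¹ * z) : ℝ≥0) : ℝ) ((normAbs F u : ℝ≥0) : ℝ)) : ℝ) : ℂ) ^ (-s) * ((ψ (u * (x⁻¹ * ξ)) : Circle) : ℂ) ∂μ)))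
  rw [map_inv₀, NNReal.coe_inv, eq_comm, inv_smul_eq_iff₀ hxpos.ne'] at hsub
  simp only [inv_mul_cancel_left₀ hx0] at hsub
  rw [hsub]
  -- `max(1,‖x‖,‖x z'‖) = ‖x‖ max(1,‖z'‖)`
  have hpt : ∀ z : F, ((max 1 (max ((normAbs F x : ℝ≥0) : ℝ) ((normAbs F (x * z) : ℝ≥0) : ℝ)) : ℝ) : ℂ) ^ (-s) *
      (((ψ (z * ξ) : Circle) : ℂ) * ((((normAbs F x : ℝ≥0) : ℝ)⁻¹ : ℝ) *
        ∫ u, ((max 1 (max ((normAbs F z : ℝ≥0) : ℝ) ((normAbs F u : ℝ≥0) : ℝ)) : ℝ) : ℂ) ^ (-s) * ((ψ (u * (x⁻¹ * ξ)) : Circle) : ℂ) ∂μ)) =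
      ((((normAbs F x : ℝ≥0) : ℝ) : ℂ) ^ (-s) * ((((normAbs F x : ℝ≥0) : ℝ)⁻¹ : ℝ) : ℂ)) *
        ((((max 1 ((normAbs F z : ℝ≥0) : ℝ) : ℝ) : ℂ) ^ (-s) *
            ∫ u, ((max 1 (max ((normAbs F z : ℝ≥0) : ℝ) ((normAbs F u : ℝ≥0) : ℝ)) : ℝ) : ℂ) ^ (-s) * ((ψ (u * (x⁻¹ * ξ)) : Circle) : ℂ) ∂μ) *
          ((ψ (z * ξ) : Circle) : ℂ)) := by
    intro z
    rw [map_mul, NNReal.coe_mul, max_one_max_eq_mul hxR, inv_mul_cancel_left₀ hxpos.ne', Complex.ofReal_mul,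
      Complex.mul_cpow_ofReal_nonneg hxpos.le (le_trans zero_le_one (le_max_left _ _))]
    ring
  simp_rw [hpt]
  rw [integral_const_mul, Complex.real_smul, ← mul_assoc, ← mul_assoc, Complex.ofReal_inv, mul_comm (((normAbs F x : ℝ≥0) : ℝ) : ℂ),
    mul_assoc (((((normAbs F x : ℝ≥0) : ℝ) : ℂ)) ^ (-s)), mul_inv_cancel₀ (by exact_mod_cast hxpos.ne' : (((normAbs F x : ℝ≥0) : ℝ) : ℂ) ≠ 0), mul_one]

/-- The radial weight `z ↦ max(1,‖z‖)^{−s}·G_η(z)` of the previous formula is integrable for `Re s > 1` (★ p858040 times a bounded measurable factor). [folklore] -/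
theorem integrable_maxOne_cpow_mul_floorIntegral {ψ : AddChar F Circle} (hψ : Continuous ψ) (η : F) {s : ℂ} (hs : 1 < s.re) :
    Integrable (fun z : F => ((max 1 ((normAbs F z : ℝ≥0) : ℝ) : ℝ) : ℂ) ^ (-s) *
      ∫ u, ((max 1 (max ((normAbs F z : ℝ≥0) : ℝ) ((normAbs F u : ℝ≥0) : ℝ)) : ℝ) : ℂ) ^ (-s) * ((ψ (u * η) : Circle) : ℂ) ∂μ) μ :=
  (integrable_and_integral_max_one_normAbs_cpow μ hs).1.mul_bdd (aestronglyMeasurable_floorIntegral μ hψ η s)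
    (Eventually.of_forall fun z => norm_floorIntegral_le μ η hs z)

/-- **THE FIBRE ON THE SPHERE `‖x‖ = q`** (`ψ` of conductor exponent `m`, `ξ ∈ 𝔭^m ∖ 𝔭^{m+1}`, `Re s > 1`; `c := q^{−s}`):
`Fib(x) = μ(𝒪)² · c · (1 + (q−1)c − 2q c² + q c³)` — §5 at `‖x‖ = q` (frequency `x⁻¹ξ` of level `m+1`, §3) and the shell formula in `z'` (level `m`, §3).
[cite: Casselman1980, Thm. 3.1] [cite: CasselmanShalika1980, Thm. 5.4] -/
theorem integral_fibre_twisted_of_mem_outerShell_zero {x : F} (hxS : x ∈ primePowBall F (-(((0 : ℕ) : ℤ) + 1)) \ primePowBall F (-(((0 : ℕ) : ℤ) + 1) + 1))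
    {ψ : AddChar F Circle} (hψ : Continuous ψ) {m : ℤ} (hm : ψ.HasConductorExp m)
    {ξ : F} (hξ : ξ ∈ primePowBall F m) (hξ' : ξ ∉ primePowBall F (m + 1)) {s : ℂ} (hs : 1 < s.re) :
    ∫ z, ((max 1 (max ((normAbs F x : ℝ≥0) : ℝ) ((normAbs F z : ℝ≥0) : ℝ)) : ℝ) : ℂ) ^ (-s) *
        (∫ y, ((max 1 (max ((normAbs F y : ℝ≥0) : ℝ) ((normAbs F (z - x * y) : ℝ≥0) : ℝ)) : ℝ) : ℂ) ^ (-s) * ((ψ (y * ξ) : Circle) : ℂ) ∂μ) ∂μ =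
      (μ.real (primePowBall F 0) : ℂ) ^ 2 * ((residueFieldCard F : ℂ) ^ (-s) *
        (1 + ((residueFieldCard F : ℂ) - 1) * (residueFieldCard F : ℂ) ^ (-s) - 2 * (residueFieldCard F : ℂ) * ((residueFieldCard F : ℂ) ^ (-s)) ^ 2 +
          (residueFieldCard F : ℂ) * ((residueFieldCard F : ℂ) ^ (-s)) ^ 3)) := by
  have hq1R : (1 : ℝ) < residueFieldCard F := one_lt_residueFieldCard_real
  have hxq : ((normAbs F x : ℝ≥0) : ℝ) = residueFieldCard F := by rw [coe_normAbs_of_mem_outerShell hxS, zero_add, pow_one]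
  have hx : 1 ≤ normAbs F x := by
    have h : (1 : ℝ) ≤ ((normAbs F x : ℝ≥0) : ℝ) := hxq ▸ hq1R.le
    exact_mod_cast h
  have hx0 : x ≠ 0 := ne_zero_of_mem_shell hxS
  -- the dilated frequency `x⁻¹ ξ` has level `m + 1`
  have hxinv : normAbs F x⁻¹ = (residueFieldCard F : ℝ≥0)⁻¹ ^ (1 : ℤ) := by
    rw [map_inv₀, zpow_one, show normAbs F x = (residueFieldCard F : ℝ≥0) by exact_mod_cast hxq]
  have hη : x⁻¹ * ξ ∈ primePowBall F (m + 1) := by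
    have h := mul_mem_primePowBall (mem_primePowBall_iff.2 hxinv.le) hξ
    rwa [add_comm] at h
  have hη' : x⁻¹ * ξ ∉ primePowBall F (m + 1 + 1) := by
    intro h
    apply hξ'
    have h2 : x * (x⁻¹ * ξ) ∈ primePowBall F (-1 + (m + 1 + 1)) :=
      mul_mem_primePowBall (mem_primePowBall_iff.2 (by rw [← inv_inv x, map_inv₀, hxinv, ← zpow_neg])) h
    rwa [mul_inv_cancel_left₀ hx0, show (-1 : ℤ) + (m + 1 + 1) = m + 1 by ring] at h2
  rw [integral_fibre_twisted_of_one_le μ hx ψ ξ s, hxq, Complex.ofReal_natCast,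
    integral_radial_mul_addChar_eq μ (integrable_maxOne_cpow_mul_floorIntegral μ hψ (x⁻¹ * ξ) hs) (fun y y' h => by simp only [h]) hψ hm (n := 0)
      (by rwa [Nat.cast_zero, add_zero]) (by rwa [Nat.cast_zero, add_zero])]
  -- the radial weight on `𝒪` and on the sphere `‖z'‖ = q`
  have hball : ∀ z ∈ primePowBall F (-(1 : ℤ)), ∫ u, ((max 1 (max ((normAbs F z : ℝ≥0) : ℝ) ((normAbs F u : ℝ≥0) : ℝ)) : ℝ) : ℂ) ^ (-s) * ((ψ (u * (x⁻¹ * ξ)) : Circle) : ℂ) ∂μ =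
      (μ.real (primePowBall F 0) : ℂ) * ((((max 1 ((normAbs F z : ℝ≥0) : ℝ)) : ℝ) : ℂ) ^ (-s) + ((residueFieldCard F : ℂ) - 1) * (residueFieldCard F : ℂ) ^ (-s) -
          (residueFieldCard F : ℂ) * ((residueFieldCard F : ℂ) ^ (-s)) ^ 2) := fun z hz => integral_floorWeight_mul_addChar_of_level_one μ hψ hm hη hη' hs hz
  have h0 : ∫ z in primePowBall F (-((0 : ℕ) : ℤ)), ((max 1 ((normAbs F z : ℝ≥0) : ℝ) : ℝ) : ℂ) ^ (-s) *
      ∫ u, ((max 1 (max ((normAbs F z : ℝ≥0) : ℝ) ((normAbs F u : ℝ≥0) : ℝ)) : ℝ) : ℂ) ^ (-s) * ((ψ (u * (x⁻¹ * ξ)) : Circle) : ℂ) ∂μ ∂μ =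
      (μ.real (primePowBall F 0) : ℂ) * ((μ.real (primePowBall F 0) : ℂ) * (1 + ((residueFieldCard F : ℂ) - 1) * (residueFieldCard F : ℂ) ^ (-s) -
          (residueFieldCard F : ℂ) * ((residueFieldCard F : ℂ) ^ (-s)) ^ 2)) := by
    rw [show (-((0 : ℕ) : ℤ)) = 0 by simp, setIntegral_congr_fun (measurableSet_primePowBall 0) (fun z hz => by
      rw [hball z (primePowBall_antitone (by norm_num) hz), max_eq_left (coe_normAbs_le_one_of_mem hz), Complex.ofReal_one, Complex.one_cpow, one_mul]),
      setIntegral_const, Complex.real_smul]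
  have h1 : ∫ z in primePowBall F (-(((0 : ℕ) : ℤ) + 1)) \ primePowBall F (-(((0 : ℕ) : ℤ) + 1) + 1), ((max 1 ((normAbs F z : ℝ≥0) : ℝ) : ℝ) : ℂ) ^ (-s) *
      ∫ u, ((max 1 (max ((normAbs F z : ℝ≥0) : ℝ) ((normAbs F u : ℝ≥0) : ℝ)) : ℝ) : ℂ) ^ (-s) * ((ψ (u * (x⁻¹ * ξ)) : Circle) : ℂ) ∂μ ∂μ =
      (((residueFieldCard F : ℝ) - 1) * μ.real (primePowBall F 0) : ℝ) * ((residueFieldCard F : ℂ) ^ (-s) * ((μ.real (primePowBall F 0) : ℂ) *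
        ((residueFieldCard F : ℂ) ^ (-s) + ((residueFieldCard F : ℂ) - 1) * (residueFieldCard F : ℂ) ^ (-s) - (residueFieldCard F : ℂ) * ((residueFieldCard F : ℂ) ^ (-s)) ^ 2))) := by
    rw [setIntegral_congr_fun (measurableSet_shell _) (fun z hz => by
      rw [hball z hz.1, coe_normAbs_of_mem_outerShell hz, zero_add, pow_one, max_eq_right hq1R.le, Complex.ofReal_natCast]),
      setIntegral_const, Complex.real_smul, measureReal_outerShell, zero_add, pow_one]
    have hq : (residueFieldCard F : ℂ) ≠ 0 := Nat.cast_ne_zero.2 (residueFieldCard_ne_zero F)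
    congr 1
    push_cast
    rw [mul_sub, mul_one, mul_inv_cancel₀ hq]
  rw [h0, h1]
  have hq1 : (residueFieldCard F : ℂ) - 1 ≠ 0 := by
    rw [sub_ne_zero]; exact_mod_cast (one_lt_residueFieldCard F).ne'
  push_cast
  field_simp
  ring

/-! ## §6  `Fib` is radial and integrable (every frequency) -/

/-- **`Fib` IS RADIAL** (every `ψ`, `ξ`, `s`): `‖x‖ = ‖x'‖ ⟹ Fib(x) = Fib(x')` — substitute `z ↦ vz` with the unit `v = x'x⁻¹` (`‖vz‖ = ‖z‖`, `vz − x'y = v(z − xy)`). [folklore] -/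
theorem integral_fibre_twisted_radial (ψ : AddChar F Circle) (ξ : F) (s : ℂ) (x x' : F) (h : normAbs F x = normAbs F x') :
    ∫ z, ((max 1 (max ((normAbs F x : ℝ≥0) : ℝ) ((normAbs F z : ℝ≥0) : ℝ)) : ℝ) : ℂ) ^ (-s) *
        (∫ y, ((max 1 (max ((normAbs F y : ℝ≥0) : ℝ) ((normAbs F (z - x * y) : ℝ≥0) : ℝ)) : ℝ) : ℂ) ^ (-s) * ((ψ (y * ξ) : Circle) : ℂ) ∂μ) ∂μ =
      ∫ z, ((max 1 (max ((normAbs F x' : ℝ≥0) : ℝ) ((normAbs F z : ℝ≥0) : ℝ)) : ℝ) : ℂ) ^ (-s) *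
        (∫ y, ((max 1 (max ((normAbs F y : ℝ≥0) : ℝ) ((normAbs F (z - x' * y) : ℝ≥0) : ℝ)) : ℝ) : ℂ) ^ (-s) * ((ψ (y * ξ) : Circle) : ℂ) ∂μ) ∂μ := by
  by_cases hx0 : x = 0
  · have hx' : x' = 0 := by rwa [hx0, map_zero, eq_comm, map_eq_zero] at h
    rw [hx0, hx']
  set v : F := x' * x⁻¹ with hv_def
  have hv : normAbs F v = 1 := by
    rw [hv_def, map_mul, map_inv₀, ← h, mul_inv_cancel₀ ((map_ne_zero (normAbs F)).2 hx0)]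
  have hx'v : x' = v * x := by rw [hv_def, inv_mul_cancel_right₀ hx0]
  symm
  calc ∫ z, ((max 1 (max ((normAbs F x' : ℝ≥0) : ℝ) ((normAbs F z : ℝ≥0) : ℝ)) : ℝ) : ℂ) ^ (-s) *
        (∫ y, ((max 1 (max ((normAbs F y : ℝ≥0) : ℝ) ((normAbs F (z - x' * y) : ℝ≥0) : ℝ)) : ℝ) : ℂ) ^ (-s) * ((ψ (y * ξ) : Circle) : ℂ) ∂μ) ∂μ
      = ∫ z, ((max 1 (max ((normAbs F x' : ℝ≥0) : ℝ) ((normAbs F (v * z) : ℝ≥0) : ℝ)) : ℝ) : ℂ) ^ (-s) *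
        (∫ y, ((max 1 (max ((normAbs F y : ℝ≥0) : ℝ) ((normAbs F (v * z - x' * y) : ℝ≥0) : ℝ)) : ℝ) : ℂ) ^ (-s) * ((ψ (y * ξ) : Circle) : ℂ) ∂μ) ∂μ :=
        (integral_comp_mul_left_of_normAbs_eq_one μ _ hv).symm
    _ = _ := integral_congr_ae (Eventually.of_forall fun z => by
        simp only
        rw [map_mul, hv, one_mul, ← h]
        congr 2
        funext y
        rw [hx'v, show v * z - v * x * y = v * (z - x * y) by ring, map_mul, hv, one_mul])

omit [MeasurableSpace F] [BorelSpace F] in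
/-- The twisted big-cell integrand `((x,z),y) ↦ max(1,‖y‖,‖z−xy‖)^{−s} ψ(yξ)` is continuous on `(F × F) × F`. [folklore] -/
theorem continuous_innerIntegrand (ψ : AddChar F Circle) (hψ : Continuous ψ) (ξ : F) (s : ℂ) :
    Continuous fun p : (F × F) × F => ((max 1 (max ((normAbs F p.2 : ℝ≥0) : ℝ) ((normAbs F (p.1.2 - p.1.1 * p.2) : ℝ≥0) : ℝ)) : ℝ) : ℂ) ^ (-s) *
      ((ψ (p.2 * ξ) : Circle) : ℂ) :=
  (continuous_ofReal_cpow_neg (continuous_const.max ((continuous_coe_normAbs.comp continuous_snd).max (continuous_coe_normAbs.comp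
    ((continuous_snd.comp continuous_fst).sub ((continuous_fst.comp continuous_fst).mul continuous_snd))))) (fun _ => le_max_left _ _) s).mul
    (continuous_subtype_val.comp (hψ.comp (continuous_snd.mul continuous_const)))

/-- `(x,z) ↦ max(1,‖x‖,‖z‖)^{−s}·I(x,z)` is a.e.-strongly measurable on `F × F` (continuous factor times a parametric integral of a continuous kernel). [folklore] -/
theorem aestronglyMeasurable_fibreIntegrand {ψ : AddChar F Circle} (hψ : Continuous ψ) (ξ : F) (s : ℂ) :
    AEStronglyMeasurable (fun p : F × F => ((max 1 (max ((normAbs F p.1 : ℝ≥0) : ℝ) ((normAbs F p.2 : ℝ≥0) : ℝ)) : ℝ) : ℂ) ^ (-s) *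
      ∫ y, ((max 1 (max ((normAbs F y : ℝ≥0) : ℝ) ((normAbs F (p.2 - p.1 * y) : ℝ≥0) : ℝ)) : ℝ) : ℂ) ^ (-s) * ((ψ (y * ξ) : Circle) : ℂ) ∂μ) (μ.prod μ) := by
  haveI : T2Space F := (isLocalField F).toT2Space
  haveI : SecondCountableTopology F := secondCountableTopology_localField F
  exact (continuous_ofReal_cpow_neg (continuous_const.max ((continuous_coe_normAbs.comp continuous_fst).max (continuous_coe_normAbs.comp continuous_snd)))
    (fun _ => le_max_left _ _) s).aestronglyMeasurable.mul ((continuous_innerIntegrand ψ hψ ξ s).aestronglyMeasurable (μ := (μ.prod μ).prod μ)).integral_prod_right'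

/-- **`Fib` IS INTEGRABLE** for `Re s > 1` (every continuous `ψ`, every `ξ`): `|Fib(x)| ≤ ∫_z∫_y max(1,‖x‖,‖z‖)^{−σ} max(1,‖y‖,‖z−xy‖)^{−σ}` (`σ = Re s`, `|ψ| = 1`), the `x`-marginal of
the ★ Haar-form Gindikin–Karpelevich integrand, integrable by ★ `integrable_bigCellIntegrand`. [cite: Casselman1980, Thm. 3.1] [cite: Langlands1971, §3] -/
theorem integrable_fibre_twisted {ψ : AddChar F Circle} (hψ : Continuous ψ) (ξ : F) {s : ℂ} (hs : 1 < s.re) :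
    Integrable (fun x : F => ∫ z, ((max 1 (max ((normAbs F x : ℝ≥0) : ℝ) ((normAbs F z : ℝ≥0) : ℝ)) : ℝ) : ℂ) ^ (-s) *
        (∫ y, ((max 1 (max ((normAbs F y : ℝ≥0) : ℝ) ((normAbs F (z - x * y) : ℝ≥0) : ℝ)) : ℝ) : ℂ) ^ (-s) * ((ψ (y * ξ) : Circle) : ℂ) ∂μ) ∂μ) μ := by
  haveI : T2Space F := (isLocalField F).toT2Space
  haveI : SecondCountableTopology F := secondCountableTopology_localField F
  haveI : LocallyCompactSpace F := (isLocalField F).toLocallyCompactSpace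
  refine ((integrable_bigCellIntegrand μ hs).integral_norm_prod_left).mono' (aestronglyMeasurable_fibreIntegrand μ hψ ξ s).integral_prod_right'
    (Eventually.of_forall fun x => ?_)
  -- pointwise domination of the fibre
  have hA : ∀ z : F, (0 : ℝ) ≤ (max 1 (max ((normAbs F x : ℝ≥0) : ℝ) ((normAbs F z : ℝ≥0) : ℝ))) ^ (-s.re) := fun z => Real.rpow_nonneg (le_trans zero_le_one (le_max_left _ _)) _
  have hB : ∀ z y : F, (0 : ℝ) ≤ (max 1 (max ((normAbs F y : ℝ≥0) : ℝ) ((normAbs F (z - x * y) : ℝ≥0) : ℝ))) ^ (-s.re) := fun z y => Real.rpow_nonneg (le_trans zero_le_one (le_max_left _ _)) _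
  have hI : ∀ z : F, ‖∫ y, ((max 1 (max ((normAbs F y : ℝ≥0) : ℝ) ((normAbs F (z - x * y) : ℝ≥0) : ℝ)) : ℝ) : ℂ) ^ (-s) * ((ψ (y * ξ) : Circle) : ℂ) ∂μ‖ ≤
      ∫ y, (max 1 (max ((normAbs F y : ℝ≥0) : ℝ) ((normAbs F (z - x * y) : ℝ≥0) : ℝ))) ^ (-s.re) ∂μ := fun z =>
    norm_integral_le_of_norm_le (integrable_inner μ hs x z) (Eventually.of_forall fun y => (norm_weight_mul_addChar _ (le_max_left _ _) s _).le)
  have hpt : ∀ z : F, ‖((max 1 (max ((normAbs F x : ℝ≥0) : ℝ) ((normAbs F z : ℝ≥0) : ℝ)) : ℝ) : ℂ) ^ (-s) *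
      ∫ y, ((max 1 (max ((normAbs F y : ℝ≥0) : ℝ) ((normAbs F (z - x * y) : ℝ≥0) : ℝ)) : ℝ) : ℂ) ^ (-s) * ((ψ (y * ξ) : Circle) : ℂ) ∂μ‖ ≤
      ∫ y, ‖(max 1 (max ((normAbs F x : ℝ≥0) : ℝ) ((normAbs F z : ℝ≥0) : ℝ))) ^ (-s.re) * (max 1 (max ((normAbs F y : ℝ≥0) : ℝ) ((normAbs F (z - x * y) : ℝ≥0) : ℝ))) ^ (-s.re)‖ ∂μ := by
    intro z
    rw [norm_mul, norm_ofReal_cpow_neg (le_max_left _ _)]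
    calc (max 1 (max ((normAbs F x : ℝ≥0) : ℝ) ((normAbs F z : ℝ≥0) : ℝ))) ^ (-s.re) *
          ‖∫ y, ((max 1 (max ((normAbs F y : ℝ≥0) : ℝ) ((normAbs F (z - x * y) : ℝ≥0) : ℝ)) : ℝ) : ℂ) ^ (-s) * ((ψ (y * ξ) : Circle) : ℂ) ∂μ‖
        ≤ (max 1 (max ((normAbs F x : ℝ≥0) : ℝ) ((normAbs F z : ℝ≥0) : ℝ))) ^ (-s.re) *
          ∫ y, (max 1 (max ((normAbs F y : ℝ≥0) : ℝ) ((normAbs F (z - x * y) : ℝ≥0) : ℝ))) ^ (-s.re) ∂μ := mul_le_mul_of_nonneg_left (hI z) (hA z)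
      _ = ∫ y, ‖(max 1 (max ((normAbs F x : ℝ≥0) : ℝ) ((normAbs F z : ℝ≥0) : ℝ))) ^ (-s.re) * (max 1 (max ((normAbs F y : ℝ≥0) : ℝ) ((normAbs F (z - x * y) : ℝ≥0) : ℝ))) ^ (-s.re)‖ ∂μ := by
          rw [← integral_const_mul]
          exact integral_congr_ae (Eventually.of_forall fun y => (Real.norm_of_nonneg (mul_nonneg (hA z) (hB z y))).symm)
  calc ‖∫ z, ((max 1 (max ((normAbs F x : ℝ≥0) : ℝ) ((normAbs F z : ℝ≥0) : ℝ)) : ℝ) : ℂ) ^ (-s) *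
        (∫ y, ((max 1 (max ((normAbs F y : ℝ≥0) : ℝ) ((normAbs F (z - x * y) : ℝ≥0) : ℝ)) : ℝ) : ℂ) ^ (-s) * ((ψ (y * ξ) : Circle) : ℂ) ∂μ) ∂μ‖
      ≤ ∫ z, ‖((max 1 (max ((normAbs F x : ℝ≥0) : ℝ) ((normAbs F z : ℝ≥0) : ℝ)) : ℝ) : ℂ) ^ (-s) *
        (∫ y, ((max 1 (max ((normAbs F y : ℝ≥0) : ℝ) ((normAbs F (z - x * y) : ℝ≥0) : ℝ)) : ℝ) : ℂ) ^ (-s) * ((ψ (y * ξ) : Circle) : ℂ) ∂μ)‖ ∂μ :=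
        norm_integral_le_integral_norm _
    _ ≤ ∫ z, ∫ y, ‖(max 1 (max ((normAbs F x : ℝ≥0) : ℝ) ((normAbs F z : ℝ≥0) : ℝ))) ^ (-s.re) * (max 1 (max ((normAbs F y : ℝ≥0) : ℝ) ((normAbs F (z - x * y) : ℝ≥0) : ℝ))) ^ (-s.re)‖ ∂μ ∂μ :=
        integral_mono_of_nonneg (Eventually.of_forall fun z => norm_nonneg _) (integrable_zySection μ hs x).integral_norm_prod_left (Eventually.of_forall hpt)
    _ = ∫ p : F × F, ‖(max 1 (max ((normAbs F x : ℝ≥0) : ℝ) ((normAbs F p.1 : ℝ≥0) : ℝ))) ^ (-s.re) * (max 1 (max ((normAbs F p.2 : ℝ≥0) : ℝ) ((normAbs F (p.1 - x * p.2) : ℝ≥0) : ℝ))) ^ (-s.re)‖ ∂(μ.prod μ) :=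
        (integral_prod _ (integrable_zySection μ hs x).norm).symm
end Summit.HodgeConjecture.HodgeConjecture.Cruxes.H413.K2E1FiniteWhittakerSplitU3Fibre

end
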